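import Summits.HodgeConjecture.HodgeConjecture.Theorems.LimitExtensionMidSmoothNearGoodFibre
import Summits.HodgeConjecture.HodgeConjecture.Theorems.AnchorTransportVariationalHodgeQuasiProjective
import Literature.AlgebraicGeometry.HodgeTheory.AlgebraicityLocusCurveBaseDichotomy
import Literature.AlgebraicGeometry.HodgeTheory.HyperplaneSectionMonodromySmoothLocus
import Literature.AlgebraicGeometry.HodgeTheory.IsoTransport
import Literature.AlgebraicGeometry.HodgeTheory.TopDegreeClasses
import Literature.AlgebraicGeometry.HodgeTheory.QuasiProjectiveOfAffine
import Literature.AlgebraicGeometry.Motives.SmoothProjectiveFamilyOverOpen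
import Literature.AlgebraicGeometry.Motives.FlatOverSmoothCurve
import Literature.AlgebraicGeometry.Motives.HypersurfaceFieldPoints
import Literature.NumberTheory.Transcendental.AnalytificationConnectedOpen
import Literature.NumberTheory.Transcendental.AnalytificationSecondCountableProofs
import HarnessLib

/-!
# Crux `MovableClassesAlgebraic` (stmt-HodgeConjecture-1493) — stub 3 `stub_specialisation`: algebraicity of the fibre restrictions of a global class specialises along a curve

Route `FiniteTreeOfFlavours`, crux #3 `Theses.FiniteTreeOfFlavours.MovableClassesAlgebraic`, registered
skeleton `Cruxes/MovableClassesAlgebraic/Lines/birth.lean` ("explain the movable class at the generic fibre, then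
specialise"). Its STUB 3 `stub_specialisation` ("known in print": Charles–Schnell Prop. 11.3.11; Voisin II
§3.3.1 and proof of Thm. 7.19), proved here with its REGISTERED SIGNATURE VERBATIM:

> for `π : 𝒴 ⟶ C` with `𝒴` a smooth projective `(n+1)`-fold and `C` a smooth projective curve, and ANY class
> `Λ ∈ H²ᵏ(𝒴(ℂ); ℂ)`: if `Λ|_{𝒴_{t'}}` is algebraic for all complex points `t'` off a proper Zariski-closed
> `S ⊊ C`, then `Λ|_{𝒴_t}` is algebraic at EVERY complex point `t` whose fibre is a smooth projective `n`-fold.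

Proof (all inputs are tree THEOREMS; no named fact): `π` is proper and DOMINANT (otherwise every point of
`𝒴` lies over `pt t`, the closed immersion `𝒴_t ↪ 𝒴` is onto the reduced `𝒴`, hence an isomorphism, and
the relative dimensions `n` and `n + 1` of `𝒴_t → Spec ℂ` coincide — absurd), hence FLAT over the smooth
curve `C` (Hartshorne III.9.7, `Motives.flat_of_isDominant_of_smoothCurve`); by the fibre criterion
(`Theorems.exists_smoothOfRelativeDimension_nhd_of_isSmoothProjective_fiberOver`, EGA IV 17.5.1) `π` is
smooth of relative dimension `n` over an affine open `V ∋ pt t`, and all fibres over `V` are smooth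
projective `n`-folds (projective as closed subschemes of `𝒴`; geometrically irreducible by Ehresmann from
the connected fibre `𝒴_t`, `SectionFamily.geometricallyIrreducible_fiberOver_of_connectedSpace`). So
`𝒴 ×_C V ⟶ V` is a smooth projective family with quasi-projective total space over the smooth integral
affine curve `V`, and `Λ|_{𝒴 ×_C V}` is a global class whose fibre restrictions are algebraic at the
UNCOUNTABLY many complex points of `V` off `S` (`S ∩ V` is finite); by the curve-base dichotomy of the
DISCHARGED structure theorem on algebraicity loci (`charlesSchnell_algebraicityLocus_iUnion_closed_holds`,
`HodgeTheory.mem_algebraicClasses_of_not_countable_of_smoothCurve`) they are algebraic at every complex point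
of `V`, in particular at `t`.

No definition, no named fact, no `sorry`.

References: [CharlesSchnell2014Notes] F. Charles, C. Schnell, Notes on absolute Hodge classes (2014),
Prop. 11.3.11 and its proof; [VoisinHodgeII2003] C. Voisin, Hodge Theory and Complex Algebraic Geometry II
(2003), §3.3.1, §7.3.2; [Hartshorne1977] R. Hartshorne, Algebraic Geometry (1977), III Prop. 9.7, Prop. 10.1;
[EGAIV4] A. Grothendieck, EGA IV₄, Thm. 17.5.1.
-/

-- `Summit.<Summit>.<Problem>`: for the single-conjunct summit `HodgeConjecture` the duplicate component is mandated.
set_option linter.dupNamespace false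

noncomputable section

open CategoryTheory CategoryTheory.Limits AlgebraicGeometry TopologicalSpace
open Literature.AlgebraicGeometry Literature.AlgebraicGeometry.Motives Literature.AlgebraicGeometry.HodgeTheory

namespace Summit.HodgeConjecture.HodgeConjecture.Theorems

section Specialisation

variable {n : ℕ} {𝒴 C : SchemeOver ℂ} (π : 𝒴 ⟶ C)

/-- **A morphism from a smooth projective `(n+1)`-fold to a smooth projective curve with one smooth
projective `n`-dimensional fibre is dominant**: otherwise every point of `𝒴` lies over `pt t`
(`isDominant_of_apply_eq_of_apply_ne` fails only then), the closed immersion `𝒴_t ↪ 𝒴` is surjective onto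
the reduced `𝒴`, hence an isomorphism (`isIso_of_isClosedImmersion_of_surjective`), and `𝒴_t ⟶ Spec ℂ` would
be smooth of relative dimensions `n` and `0 + (n + 1)` at once (`AbelianVarietyProofs.eq_of_smoothOfRelativeDimension`).
[cite: Hartshorne1977, II Ex. 3.22 and III Prop. 9.7] -/
theorem isDominant_of_isSmoothProjective_fiberOver (h𝒴 : IsSmoothProjective (n + 1) 𝒴)
    (hC : IsSmoothProjective 1 C) (t : ComplexPoints C) (ht : IsSmoothProjective n (fiberOver π t)) :
    IsDominant π.left := by
  haveI : IsIntegral 𝒴.left := IsSmoothProjective.isIntegral_holds h𝒴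
  haveI : IsIntegral C.left := IsSmoothProjective.isIntegral_holds hC
  haveI := hC.smoothOfRelativeDimension
  haveI := h𝒴.smoothOfRelativeDimension
  haveI : IrreducibleSpace (fiberOver π t).left := ht.irreducibleSpace
  -- a point of the fibre
  obtain ⟨z⟩ := (inferInstance : Nonempty (fiberOver π t).left)
  have hz : π.left ((fiberι π t).left z) = t.pt := by
    have hcomp := congrArg (fun g ↦ g.left.base z) (fiberι_comp π t)
    simp only [Over.comp_left, Scheme.Hom.comp_base, TopCat.coe_comp, Function.comp_apply] at hcomp
    rw [hcomp]
    haveI : Subsingleton ((specOver ℂ ℂ).left : Type) := inferInstanceAs (Subsingleton (PrimeSpectrum ℂ))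
    rw [Subsingleton.elim ((fiberOverToSpec π t).left.base z) (IsLocalRing.closedPoint ℂ)]
    rfl
  by_cases hall : ∀ w : 𝒴.left, π.left w = t.pt
  · -- every point lies over `pt t`: the fibre inclusion is a surjective closed immersion, an iso
    exfalso
    haveI : IsClosedImmersion (fiberι π t).left := isClosedImmersion_fiberι_left π t
    haveI : Surjective (fiberι π t).left := ⟨fun w => exists_fiberι_base_eq_of_apply_eq π t (hall w)⟩
    haveI : IsIso (fiberι π t).left := isIso_of_isClosedImmersion_of_surjective _
    have h1 : SmoothOfRelativeDimension n (fiberOver π t).hom := ht.smoothOfRelativeDimension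
    have h2 : SmoothOfRelativeDimension (0 + (n + 1)) ((fiberι π t).left ≫ 𝒴.hom) := inferInstance
    have h2' : SmoothOfRelativeDimension (0 + (n + 1)) (fiberOver π t).hom := by
      rw [← Over.w (fiberι π t)]; exact h2
    have := AbelianVarietyProofs.eq_of_smoothOfRelativeDimension _ h1 h2'
    omega
  · push Not at hall
    obtain ⟨w, hw⟩ := hall
    exact isDominant_of_apply_eq_of_apply_ne (T := C) π.left ((fiberι π t).left z) w hz hw

/-- **STUB 3 `stub_specialisation` of crux `MovableClassesAlgebraic` (stmt-HodgeConjecture-1493), registered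
signature VERBATIM** — algebraicity of the fibre restrictions of a global class specialises from the fibres
off a proper closed subset of the base curve to every smooth projective fibre. See the module docstring for
the proof. [cite: CharlesSchnell2014Notes, Prop. 11.3.11 (proof)] [cite: VoisinHodgeII2003, §3.3.1 and §7.3.2]
[cite: Hartshorne1977, III Prop. 9.7] -/
theorem stub_specialisation :
    ∀ ⦃n : ℕ⦄ ⦃𝒴 C : SchemeOver ℂ⦄ (π : 𝒴 ⟶ C),
      IsSmoothProjective (n + 1) 𝒴 → IsSmoothProjective 1 C →
      ∀ (k : ℕ) (Λ : complexBetti 𝒴 (2 * k)) (S : Set C.left), IsClosed S → S ≠ Set.univ →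
        (∀ t' : AlgPoints C ℂ, t'.pt ∉ S →
          (complexBetti.map (fiberι π t') (2 * k)).hom Λ ∈ algebraicClasses (fiberOver π t') k) →
        ∀ t : AlgPoints C ℂ, IsSmoothProjective n (fiberOver π t) →
          (complexBetti.map (fiberι π t) (2 * k)).hom Λ ∈ algebraicClasses (fiberOver π t) k := by
  intro n 𝒴 C π h𝒴 hC k Λ S hS hSu halg t ht
  -- ### instances on `𝒴`, `C`, `π`
  haveI : IsIntegral 𝒴.left := IsSmoothProjective.isIntegral_holds h𝒴
  haveI : IsIntegral C.left := IsSmoothProjective.isIntegral_holds hC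
  haveI := hC.smoothOfRelativeDimension
  haveI := h𝒴.smoothOfRelativeDimension
  haveI : IsProper 𝒴.hom := IsSmoothProjective.isProper_holds h𝒴
  haveI : IsProper C.hom := IsSmoothProjective.isProper_holds hC
  haveI : LocallyOfFiniteType C.hom := inferInstance
  haveI : LocallyOfFiniteType 𝒴.hom := inferInstance
  haveI : IsSeparated C.hom := inferInstance
  haveI : IsSeparated 𝒴.hom := inferInstance
  haveI : IsProper π.left := by
    have h : IsProper (π.left ≫ C.hom) := by rw [Over.w π]; infer_instance
    exact IsProper.of_comp π.left C.hom
  haveI : IsDominant π.left := isDominant_of_isSmoothProjective_fiberOver π h𝒴 hC t ht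
  haveI : Flat π.left := Motives.flat_of_isDominant_of_smoothCurve C π.left
  have h𝒴q : IsQuasiProjectiveOver 𝒴 := IsQuasiProjectiveOver.of_isProjectiveOver h𝒴.isProjectiveOver
  haveI : CompactSpace 𝒴.left := QuasiCompact.compactSpace_of_compactSpace 𝒴.hom
  haveI : CompactSpace C.left := QuasiCompact.compactSpace_of_compactSpace C.hom
  haveI : SecondCountableTopology (ComplexPoints 𝒴) :=
    Motives.ComplexPoints.secondCountableTopology_of_compactSpace_holds 𝒴
  haveI : SecondCountableTopology (ComplexPoints C) :=
    Motives.ComplexPoints.secondCountableTopology_of_compactSpace_holds C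
  haveI : IsLocallyNoetherian C.left := LocallyOfFiniteType.isLocallyNoetherian C.hom
  haveI : IsNoetherian C.left := {}
  -- ### `π` is smooth of relative dimension `n` over an affine open `V ∋ pt t`
  obtain ⟨V₀, htV₀, hV₀⟩ := exists_smoothOfRelativeDimension_morphismRestrict_of_forall_fibre π.left n t.pt
    (exists_smoothOfRelativeDimension_nhd_of_isSmoothProjective_fiberOver π t ht)
  obtain ⟨V, hVaff, htV, hVle⟩ := exists_isAffineOpen_mem_and_subset (U := V₀) (x := t.pt) htV₀
  haveI hsmV : SmoothOfRelativeDimension n (π.left ∣_ V) := hV₀ V hVle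
  -- ### the fibres over `V` are smooth projective `n`-folds
  haveI : ConnectedSpace (ComplexPoints (fiberOver π t)) := HodgeTheory.connectedSpace_complexPoints ht
  have hVconn : IsPreconnected {b : ComplexPoints C | b.pt ∈ V} := by
    have h := Motives.ComplexPoints.isConnected_setOf_pt_mem_inter_of_isIrreducible C isClosed_univ
      (IrreducibleSpace.isIrreducible_univ _) V ⟨t.pt, Set.mem_univ _, htV⟩
    have hset : {P : ComplexPoints C | P.pt ∈ (Set.univ : Set C.left) ∧ P.pt ∈ (V : Set C.left)} =
        {b : ComplexPoints C | b.pt ∈ V} := by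
      ext P; simp
    rw [hset] at h
    exact h.isPreconnected
  have hfib : ∀ b : ComplexPoints C, b.pt ∈ V → IsSmoothProjective n (fiberOver π b) := by
    intro b hb
    haveI : SmoothOfRelativeDimension n (fiberOver π b).hom := smoothOfRelativeDimension_fiberOver_hom π V b hb
    exact ⟨inferInstance, isProjectiveOver_fiberOver π h𝒴.isProjectiveOver b,
      SectionFamily.geometricallyIrreducible_fiberOver_of_connectedSpace (d := n) (m := 1) π V hVconn htV b hb⟩
  -- ### the smooth projective family over `V`
  set g : openSubschemeOver C V ⟶ C := openSubschemeOverι C V with hg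
  have hF : IsSmoothProjectiveFamily (familyPullback.snd π g) n :=
    SectionFamily.isSmoothProjectiveFamily_snd_openSubschemeOverι π V hsmV hfib
  haveI : IsOpenImmersion g.left := inferInstanceAs (IsOpenImmersion V.ι)
  haveI : IsAffine (openSubschemeOver C V).left := hVaff
  haveI : Nonempty (V : Scheme) := ⟨⟨t.pt, htV⟩⟩
  haveI : IsIntegral (openSubschemeOver C V).left := show IsIntegral (V : Scheme) from
    isIntegral_of_isOpenImmersion V.ι
  haveI : SmoothOfRelativeDimension 1 (openSubschemeOver C V).hom := by
    change SmoothOfRelativeDimension 1 (V.ι ≫ C.hom)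
    exact inferInstanceAs (SmoothOfRelativeDimension (0 + 1) (V.ι ≫ C.hom))
  haveI : LocallyOfFiniteType (openSubschemeOver C V).hom := by
    change LocallyOfFiniteType (V.ι ≫ C.hom); infer_instance
  have hBq : IsQuasiProjectiveOver (openSubschemeOver C V) := IsQuasiProjectiveOver.of_isAffine _
  have h𝒴Vq : IsQuasiProjectiveOver (familyPullback π g) := isQuasiProjectiveOver_familyPullback π g inferInstance h𝒴q
  -- ### lifting the points of `V`
  have hrange : Set.range (AlgPoints.map (L := ℂ) g) = {P | P.pt ∈ V} := by
    rw [AlgPoints.range_map_of_isOpenImmersion_holds]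
    ext P
    change P.pt ∈ V.ι.opensRange ↔ P.pt ∈ V
    rw [Scheme.Opens.opensRange_ι]
  -- ### the global class on the family over `V` and its fibre restrictions
  set ΛV : complexBetti (familyPullback π g) (2 * k) := complexBetti.map (familyPullback.fst π g) (2 * k) Λ
    with hΛV
  have key : ∀ u : ComplexPoints (openSubschemeOver C V),
      complexBetti.map (fiberι (familyPullback.snd π g) u) (2 * k) ΛV ∈
          algebraicClasses (fiberOver (familyPullback.snd π g) u) k ↔
        complexBetti.map (fiberι π (AlgPoints.map g u)) (2 * k) Λ ∈
          algebraicClasses (fiberOver π (AlgPoints.map g u)) k := by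
    intro u
    rw [hΛV, map_fiberι_familyPullback]
    exact mem_algebraicClasses_map_iff_of_iso (fiberOverFamilyPullbackIso π g u)
  -- ### the good set: points over `V ∖ S`, uncountable
  obtain ⟨u₀, rfl⟩ : t ∈ Set.range (AlgPoints.map (L := ℂ) g) := by rw [hrange]; exact htV
  have hG : ¬ {u : ComplexPoints (openSubschemeOver C V) | (AlgPoints.map g u).pt ∉ S}.Countable := by
    intro hc
    have hfin : {u : ComplexPoints (openSubschemeOver C V) | (AlgPoints.map g u).pt ∈ S}.Finite :=
      Set.Finite.preimage (f := AlgPoints.map (L := ℂ) g) (s := {t' : ComplexPoints C | t'.pt ∈ S})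
        (AlgPoints.map_injective_of_mono (L := ℂ) g).injOn
        (finite_setOf_pt_mem_of_isClosed_of_ne_univ (S := C) hS hSu)
    apply not_countable_univ_complexPoints_of_smoothCurve (S := openSubschemeOver C V) u₀
    refine (hc.union hfin.countable).mono fun u _ => ?_
    by_cases h : (AlgPoints.map g u).pt ∈ S
    · exact Or.inr h
    · exact Or.inl h
  have hGalg : ∀ u ∈ {u : ComplexPoints (openSubschemeOver C V) | (AlgPoints.map g u).pt ∉ S},
      complexBetti.map (fiberι (familyPullback.snd π g) u) (2 * k) ΛV ∈
        algebraicClasses (fiberOver (familyPullback.snd π g) u) k :=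
    fun u hu => (key u).2 (halg _ hu)
  -- ### the curve-base dichotomy
  have h := mem_algebraicClasses_of_not_countable_of_smoothCurve (familyPullback.snd π g) h𝒴Vq hBq hF k ΛV
    hG hGalg u₀
  exact (key u₀).1 h

end Specialisation

end Summit.HodgeConjecture.HodgeConjecture.Theorems

end
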